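import Summits.Ventures.CertifiedArithmetic.LowPrec.SRSecondMoment
import Summits.Ventures.CertifiedArithmetic.LowPrec.SRTreeDesign
import Summits.Ventures.CertifiedArithmetic.LowPrec.SRTreeIntervals
import Mathlib.Data.Nat.Log
import HarnessLib

/-!
# Summation order as a design variable, II: data-dependent bounds and the pairwise design theorem

HONEST FRAMING (venture CertifiedArithmetic / cell `pub-lowprec`): certified error envelopes and
provably optimal rounding/accumulation schemes for low-precision formats under stated cost models;
every table by two implementations; no hardware or vendor claims.

For NONNEGATIVE summands bounded by `a` the order statistic `sqNodes T = ∑_v (∑ at v)²` of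
`SRSecondMoment` is bounded by the purely combinatorial ANCESTOR WEIGHT of the tree:

* `sqNodes_le_mul_wsum` — `sqNodes T ≤ a · wsum T`, `wsum T = ∑_v (#leaves below v)·(∑ at v)`;
* `wsum_le_ancMax_mul` — `wsum T ≤ ancMax T · ∑xᵢ`, `ancMax T = max over leaves of the total
  number of leaves of its ancestors`; hence `sqNodes_le_ancMax : sqNodes T ≤ a · ancMax T · ∑xᵢ`;
* `ancMax_pairwise_le` — the pairwise tree has `ancMax + 1 ≤ 3n` (`ancMax_pairwise_two_pow`: exactly
  `2n − 2` at `n = 2^k`), and `height_pairwise_le : height ≤ ⌈log₂ n⌉`;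
* versus the left comb (recursive summation): `ancMax_comb : 2·ancMax (comb x s n) = n(n+3)`.

THE DESIGN THEOREM (every format, `valueSet_treeVar_pairwise_le`): pairwise summation of `n`
summands `0 ≤ xᵢ ≤ a` in any `Format φ` (unit roundoff `u`, subnormal quantum `q`) under SR with
no saturation has

  `Var ŝ ≤ (1 + u²)^(⌈log₂ n⌉ − 1) · (3·u²·a·n·∑xᵢ + (n − 1)·q²/4)`,

so with `amin ≤ xᵢ` (`valueSet_treeVar_pairwise_le_rel`) the RELATIVE variance is
`≤ (1+u²)^(⌈log₂n⌉−1) · 3u²·(a/amin) + floor term`: independent of `n` up to the `(1+u²)^log n`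
factor — against `u²·n/3`-type growth for recursive summation
(`SRSecondMoment.accVar_le_secondMoment` with `SRTreeDesign.sizeSq_comb`). Literature placement:
relative-model `√h·u` martingale bounds for tree summation under SR [cite: HallmanIpsen2023]
(Thm 12, Cor 13), [cite: CastroEtAl2024] §4.1; the finite-format, variance-exact, ancestor-weight
form with subnormal floor is this venture's.
-/

namespace Summit.Ventures.CertifiedArithmetic.LowPrec.SR

open Literature.ComputerArithmetic.ConnollyHighamMary2021
open Finset STree

variable {K : Type*} [Field K] [LinearOrder K] [IsStrictOrderedRing K]

/-! ### Ancestor weights -/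

/-- `wsum T = ∑_{internal v} (#leaves below v) · (exact sum at v)`. -/
def wsum : STree K → K
  | .leaf _ => 0
  | .node l r => wsum l + wsum r + ((l.leaves + r.leaves : ℕ) : K) * (l.exact + r.exact)

/-- `ancMax T` = the maximum over leaves of `∑_{ancestors v} #leaves below v` (pure shape). -/
def ancMax {L : Type*} : STree L → ℕ
  | .leaf _ => 0
  | .node l r => l.leaves + r.leaves + max (ancMax l) (ancMax r)

/-- All leaves lie in the interval `[lo, hi]` (cf. `LeavesIn F`: leaves in a finite set). -/
def LeafRange (lo hi : K) : STree K → Prop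
  | .leaf x => lo ≤ x ∧ x ≤ hi
  | .node l r => LeafRange lo hi l ∧ LeafRange lo hi r

/-- Leaves in `[lo, hi]` ⇒ `#leaves · lo ≤ ∑ ≤ #leaves · hi`. -/
theorem leafRange_sum_bounds {lo hi : K} : ∀ T : STree K, LeafRange lo hi T →
    (T.leaves : K) * lo ≤ T.exact ∧ T.exact ≤ (T.leaves : K) * hi
  | .leaf x, h => by simpa [LeafRange, STree.leaves, STree.exact] using h
  | .node l r, ⟨hl, hr⟩ => by
      obtain ⟨h1, h2⟩ := leafRange_sum_bounds l hl
      obtain ⟨h3, h4⟩ := leafRange_sum_bounds r hr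
      simp only [STree.leaves, STree.exact, Nat.cast_add]
      constructor <;> linarith

/-- **`sqNodes ≤ a · wsum`** for summands in `[0, a]`. -/
theorem sqNodes_le_mul_wsum {a : K} : ∀ T : STree K, LeafRange 0 a T → sqNodes T ≤ a * wsum T
  | .leaf _, _ => by simp [sqNodes, wsum]
  | .node l r, ⟨hl, hr⟩ => by
      have h1 := sqNodes_le_mul_wsum l hl
      have h2 := sqNodes_le_mul_wsum r hr
      obtain ⟨hl0, hla⟩ := leafRange_sum_bounds l hl
      obtain ⟨hr0, hra⟩ := leafRange_sum_bounds r hr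
      simp only [sqNodes_node, wsum, Nat.cast_add]
      have hS0 : 0 ≤ l.exact + r.exact := by nlinarith
      -- `(S_l+S_r)² ≤ (S_l+S_r)·((n_l+n_r)·a)`
      have hsq : (l.exact + r.exact) ^ 2
          ≤ a * (((l.leaves : K) + r.leaves) * (l.exact + r.exact)) := by
        rw [sq]; nlinarith
      linarith

/-- **`wsum ≤ ancMax · ∑xᵢ`** for nonnegative summands. -/
theorem wsum_le_ancMax_mul {a : K} : ∀ T : STree K, LeafRange 0 a T →
    wsum T ≤ (ancMax T : K) * T.exact
  | .leaf x, h => by simp [wsum, ancMax]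
  | .node l r, ⟨hl, hr⟩ => by
      have h1 := wsum_le_ancMax_mul l hl
      have h2 := wsum_le_ancMax_mul r hr
      obtain ⟨hl0, -⟩ := leafRange_sum_bounds l hl
      obtain ⟨hr0, -⟩ := leafRange_sum_bounds r hr
      have hl0' : 0 ≤ l.exact := by nlinarith
      have hr0' : 0 ≤ r.exact := by nlinarith
      simp only [wsum, ancMax, STree.exact, Nat.cast_add, Nat.cast_max]
      have hm1 : (ancMax l : K) ≤ max (ancMax l : K) (ancMax r) := le_max_left _ _
      have hm2 : (ancMax r : K) ≤ max (ancMax l : K) (ancMax r) := le_max_right _ _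
      nlinarith [mul_le_mul_of_nonneg_right hm1 hl0', mul_le_mul_of_nonneg_right hm2 hr0']

/-- **Ancestor bound**: `sqNodes T ≤ a · ancMax T · ∑xᵢ` for summands in `[0, a]`. -/
theorem sqNodes_le_ancMax {a : K} (T : STree K) (h : LeafRange 0 a T) :
    sqNodes T ≤ a * (ancMax T : K) * T.exact := by
  have ha : 0 ≤ a := by
    obtain ⟨h0, h1⟩ := leafRange_sum_bounds T h
    have hn : (0 : K) < T.leaves := by exact_mod_cast leaves_pos T
    nlinarith
  calc sqNodes T ≤ a * wsum T := sqNodes_le_mul_wsum T h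
    _ ≤ a * ((ancMax T : K) * T.exact) := mul_le_mul_of_nonneg_left (wsum_le_ancMax_mul T h) ha
    _ = a * (ancMax T : K) * T.exact := by ring

/-! ### The pairwise tree: ancestor weight `< 3n`, height `⌈log₂ n⌉` -/

/-- Unfolding the pairwise tree at `n ≥ 2`. -/
theorem pairwise_eq {L : Type*} (x : ℕ → L) (o : ℕ) {n : ℕ} (hn : 2 ≤ n) :
    pairwise x o n = .node (pairwise x o (n / 2)) (pairwise x (o + n / 2) ((n + 1) / 2)) := by
  obtain ⟨m, rfl⟩ : ∃ m, n = m + 2 := ⟨n - 2, by omega⟩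
  rw [pairwise]

/-- `ancMax (pairwise n) + 1 ≤ 3n` (`n ≥ 1`). -/
theorem ancMax_pairwise_le {L : Type*} (x : ℕ → L) : ∀ (n o : ℕ), 1 ≤ n →
    ancMax (pairwise x o n) + 1 ≤ 3 * n := by
  intro n
  induction n using Nat.strong_induction_on with
  | _ n ih =>
    intro o hn
    rcases Nat.lt_or_ge n 2 with h | h
    · obtain rfl : n = 1 := by omega
      simp [pairwise, ancMax]
    · rw [pairwise_eq x o h, ancMax, leaves_pairwise x _ _ (by omega),
        leaves_pairwise x _ _ (by omega)]
      have h1 := ih (n / 2) (by omega) o (by omega)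
      have h2 := ih ((n + 1) / 2) (by omega) (o + n / 2) (by omega)
      rcases Nat.lt_or_ge n 3 with h3 | h3
      · obtain rfl : n = 2 := by omega
        norm_num at h1 h2 ⊢
        simp [pairwise, ancMax]
      · have := max_le (a := ancMax (pairwise x o (n / 2)))
          (b := ancMax (pairwise x (o + n / 2) ((n + 1) / 2))) (c := 3 * ((n + 1) / 2) - 1)
          (by omega) (by omega)
        omega

/-- Perfect case: `ancMax (pairwise (2^k)) + 2 = 2 · 2^k`. -/
theorem ancMax_pairwise_two_pow {L : Type*} (x : ℕ → L) : ∀ (k o : ℕ),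
    ancMax (pairwise x o (2 ^ k)) + 2 = 2 * 2 ^ k
  | 0, o => by simp [pairwise, ancMax]
  | k + 1, o => by
      have h2 : 2 ≤ 2 ^ (k + 1) := by
        calc 2 = 2 ^ 1 := rfl
          _ ≤ 2 ^ (k + 1) := Nat.pow_le_pow_right (by norm_num) (by omega)
      have e1 : 2 ^ (k + 1) / 2 = 2 ^ k := by rw [pow_succ]; omega
      have e2 : (2 ^ (k + 1) + 1) / 2 = 2 ^ k := by rw [pow_succ]; omega
      have ha := ancMax_pairwise_two_pow x k o
      have hb := ancMax_pairwise_two_pow x k (o + 2 ^ k)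
      have hm : ancMax (pairwise x o (2 ^ k)) ≤ ancMax (pairwise x (o + 2 ^ k) (2 ^ k)) := by omega
      rw [pairwise_eq x o h2, ancMax, e1, e2, leaves_pairwise x _ _ Nat.one_le_two_pow,
        leaves_pairwise x _ _ Nat.one_le_two_pow, max_eq_right hm]
      rw [pow_succ]; omega

omit [Field K] [LinearOrder K] [IsStrictOrderedRing K] in
/-- Consistency with the perfect trees `balT` of `SRTreeIntervals`:
`pairwise x o (2^d) = balT x o d`. -/
theorem pairwise_two_pow_eq_balT (x : ℕ → K) : ∀ (d o : ℕ),
    pairwise x o (2 ^ d) = balT x o d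
  | 0, o => by simp [pairwise, balT]
  | d + 1, o => by
      have h2 : 2 ≤ 2 ^ (d + 1) := by
        calc 2 = 2 ^ 1 := rfl
          _ ≤ 2 ^ (d + 1) := Nat.pow_le_pow_right (by norm_num) (by omega)
      have e1 : 2 ^ (d + 1) / 2 = 2 ^ d := by rw [pow_succ]; omega
      have e2 : (2 ^ (d + 1) + 1) / 2 = 2 ^ d := by rw [pow_succ]; omega
      rw [pairwise_eq x o h2, e1, e2, balT, pairwise_two_pow_eq_balT x d o,
        pairwise_two_pow_eq_balT x d (o + 2 ^ d)]

/-- Height of the pairwise tree: `height ≤ ⌈log₂ n⌉ = Nat.clog 2 n`. -/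
theorem height_pairwise_le {L : Type*} (x : ℕ → L) : ∀ (n o : ℕ),
    (pairwise x o n).height ≤ Nat.clog 2 n := by
  intro n
  induction n using Nat.strong_induction_on with
  | _ n ih =>
    intro o
    rcases Nat.lt_or_ge n 2 with h | h
    · interval_cases n <;> simp [pairwise, STree.height]
    · rw [pairwise_eq x o h, STree.height, Nat.clog_of_two_le one_lt_two h]
      have h1 := (ih (n / 2) (by omega) o).trans
        (Nat.clog_mono_right 2 (by omega : n / 2 ≤ (n + 2 - 1) / 2))
      have h2 := (ih ((n + 1) / 2) (by omega) (o + n / 2)).trans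
        (Nat.clog_mono_right 2 (by omega : (n + 1) / 2 ≤ (n + 2 - 1) / 2))
      have := max_le h1 h2
      omega

/-- Recursive summation for contrast: `2 · ancMax (comb x s n) = n (n + 3)`. -/
theorem ancMax_comb {L : Type*} (x : ℕ → L) (s : L) : ∀ n : ℕ, 2 * ancMax (comb x s n) = n * (n + 3)
  | 0 => rfl
  | n + 1 => by
      have ih := ancMax_comb x s n
      have hl : (comb x s n).leaves = n + 1 := by rw [← STree.nodes_add_one, nodes_comb]
      rw [comb, ancMax, hl, STree.leaves, ancMax, Nat.max_eq_left (Nat.zero_le _)]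
      nlinarith [ih]

omit [Field K] [IsStrictOrderedRing K] in
/-- The pairwise tree's leaves are the summands: `LeafRange lo hi` from pointwise bounds. -/
theorem leafRange_pairwise {lo hi : K} (x : ℕ → K) : ∀ (n o : ℕ),
    (∀ i, o ≤ i → i < o + max n 1 → lo ≤ x i ∧ x i ≤ hi) → LeafRange lo hi (pairwise x o n) := by
  intro n
  induction n using Nat.strong_induction_on with
  | _ n ih =>
    intro o hx
    rcases Nat.lt_or_ge n 2 with h | h
    · interval_cases n <;> simpa [pairwise, LeafRange] using hx o le_rfl (by omega)
    · rw [pairwise_eq x o h, LeafRange]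
      refine ⟨ih (n / 2) (by omega) o (fun i h1 h2 => hx i h1 (by omega)),
        ih ((n + 1) / 2) (by omega) (o + n / 2) (fun i h1 h2 => hx i (by omega) (by omega))⟩

/-! ### The design theorem in every format -/

section Formats

open Literature.ComputerArithmetic.FloatingPoint

/-- **PAIRWISE SUMMATION UNDER SR, EVERY FORMAT.** For `n ≥ 1` summands `0 ≤ xᵢ ≤ a`
(`i = o, …, o+n−1`) summed pairwise in `Format φ` under SR with no saturation:
`Var ŝ = treeVar ≤ (1 + u²)^(⌈log₂ n⌉ − 1) · (u²·a·(3n)·∑xᵢ + (n − 1)·quantum²/4)`. -/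
theorem valueSet_treeVar_pairwise_le (φ : Format) (x : ℕ → ℚ) (o n : ℕ) (hn : 1 ≤ n) {a : ℚ}
    (hx : ∀ i, o ≤ i → i < o + n → 0 ≤ x i ∧ x i ≤ a)
    (h : NoSatT (MiniFloat.valueSet φ) (pairwise x o n)) :
    treeVar (MiniFloat.valueSet φ) (pairwise x o n)
      ≤ (1 + φ.unitRoundoff ^ 2) ^ (Nat.clog 2 n - 1)
        * (φ.unitRoundoff ^ 2 * (a * (3 * n) * ∑ i ∈ range n, x (o + i))
          + ((n - 1 : ℕ) : ℚ) * φ.quantum ^ 2 / 4) := by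
  have hL : LeafRange 0 a (pairwise x o n) :=
    leafRange_pairwise x n o (fun i h1 h2 => hx i h1 (by rw [max_eq_left hn] at h2; exact h2))
  have hS := exact_pairwise x n o hn
  have hnodes : (pairwise x o n).nodes = n - 1 := by
    have := STree.nodes_add_one (pairwise x o n); rw [leaves_pairwise x n o hn] at this; omega
  have h0 := valueSet_treeVar_le_secondMoment φ (pairwise x o n) h
  have hq := sqNodes_le_ancMax (pairwise x o n) hL
  have hanc : ((ancMax (pairwise x o n) : ℕ) : ℚ) ≤ 3 * n := by
    have := ancMax_pairwise_le x n o hn; exact_mod_cast (by omega : ancMax (pairwise x o n) ≤ 3 * n)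
  have hSnn : 0 ≤ ∑ i ∈ range n, x (o + i) :=
    sum_nonneg (fun i hi => (hx (o + i) (by omega) (by rw [mem_range] at hi; omega)).1)
  have ha : 0 ≤ a := by have := hx o le_rfl (by omega); linarith [this.1, this.2]
  have hu1 : (1 : ℚ) ≤ 1 + φ.unitRoundoff ^ 2 := by nlinarith [sq_nonneg φ.unitRoundoff]
  have hpow : (1 + φ.unitRoundoff ^ 2) ^ ((pairwise x o n).height - 1)
      ≤ (1 + φ.unitRoundoff ^ 2) ^ (Nat.clog 2 n - 1) :=
    pow_le_pow_right₀ hu1 (Nat.sub_le_sub_right (height_pairwise_le x n o) 1)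
  rw [hnodes] at h0
  rw [hS] at hq
  have hq' : sqNodes (pairwise x o n) ≤ a * (3 * n) * ∑ i ∈ range n, x (o + i) :=
    hq.trans (mul_le_mul_of_nonneg_right (mul_le_mul_of_nonneg_left hanc ha) hSnn)
  have hX : 0 ≤ φ.unitRoundoff ^ 2 * (a * (3 * n) * ∑ i ∈ range n, x (o + i))
      + ((n - 1 : ℕ) : ℚ) * φ.quantum ^ 2 / 4 := by positivity
  calc treeVar (MiniFloat.valueSet φ) (pairwise x o n)
      ≤ (1 + φ.unitRoundoff ^ 2) ^ ((pairwise x o n).height - 1)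
          * (φ.unitRoundoff ^ 2 * sqNodes (pairwise x o n)
            + ((n - 1 : ℕ) : ℚ) * φ.quantum ^ 2 / 4) := h0
    _ ≤ (1 + φ.unitRoundoff ^ 2) ^ ((pairwise x o n).height - 1)
          * (φ.unitRoundoff ^ 2 * (a * (3 * n) * ∑ i ∈ range n, x (o + i))
            + ((n - 1 : ℕ) : ℚ) * φ.quantum ^ 2 / 4) := by
        refine mul_le_mul_of_nonneg_left ?_ (by positivity)
        nlinarith [sq_nonneg φ.unitRoundoff]
    _ ≤ _ := mul_le_mul_of_nonneg_right hpow hX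

/-- **Dimension-free relative variance.** If moreover `0 < amin ≤ xᵢ`, then with `S = ∑xᵢ`:
`treeVar ≤ (1 + u²)^(⌈log₂ n⌉ − 1) · (3·u²·(a/amin)·S² + (n − 1)·quantum²/4)` — the relative
variance `treeVar / S²` of pairwise SR summation does not grow with `n` (up to `(1+u²)^log₂ n` and
the subnormal floor), in contrast with recursive summation. -/
theorem valueSet_treeVar_pairwise_le_rel (φ : Format) (x : ℕ → ℚ) (o n : ℕ) (hn : 1 ≤ n)
    {amin a : ℚ} (hmin : 0 < amin) (hx : ∀ i, o ≤ i → i < o + n → amin ≤ x i ∧ x i ≤ a)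
    (h : NoSatT (MiniFloat.valueSet φ) (pairwise x o n)) :
    treeVar (MiniFloat.valueSet φ) (pairwise x o n)
      ≤ (1 + φ.unitRoundoff ^ 2) ^ (Nat.clog 2 n - 1)
        * (3 * φ.unitRoundoff ^ 2 * (a / amin) * (∑ i ∈ range n, x (o + i)) ^ 2
          + ((n - 1 : ℕ) : ℚ) * φ.quantum ^ 2 / 4) := by
  have h0 := valueSet_treeVar_pairwise_le φ x o n hn
    (fun i h1 h2 => ⟨hmin.le.trans (hx i h1 h2).1, (hx i h1 h2).2⟩) h
  refine h0.trans (mul_le_mul_of_nonneg_left ?_ (by positivity))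
  -- `n · amin ≤ S`, so `a·3n·S ≤ 3 (a/amin) S²`
  have hS : (n : ℚ) * amin ≤ ∑ i ∈ range n, x (o + i) := by
    have := sum_le_sum (s := range n) (f := fun _ => amin) (g := fun i => x (o + i))
      (fun i hi => (hx (o + i) (by omega) (by rw [mem_range] at hi; omega)).1)
    simpa using this
  have ha : 0 ≤ a := by have := hx o le_rfl (by omega); linarith [this.1, this.2]
  have hSnn : 0 ≤ ∑ i ∈ range n, x (o + i) := le_trans (by positivity) hS
  have key : a * (3 * n) * ∑ i ∈ range n, x (o + i)
      ≤ 3 * (a / amin) * (∑ i ∈ range n, x (o + i)) ^ 2 := by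
    rw [div_eq_mul_inv]
    have hinv : (n : ℚ) ≤ (∑ i ∈ range n, x (o + i)) * amin⁻¹ := by
      rw [← div_eq_mul_inv, le_div_iff₀ hmin]; exact hS
    have h3 : 0 ≤ 3 * a * ∑ i ∈ range n, x (o + i) := by positivity
    nlinarith [mul_le_mul_of_nonneg_left hinv h3]
  nlinarith [sq_nonneg φ.unitRoundoff, mul_le_mul_of_nonneg_left key (sq_nonneg φ.unitRoundoff)]

end Formats

end Summit.Ventures.CertifiedArithmetic.LowPrec.SR
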